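import Summits.NavierStokesRegularity.NavierStokesRegularity.Theorems.TypeILiouvilleTypeIliouvilleNoTypeIIEternalSplitModL
import Literature.Analysis.FluidPDE.KNSSTypeIRateLiouvilleDescent
import Literature.Analysis.FluidPDE.KNSSLiouvillePlanarHolds
import HarnessLib

/-!
# Line-invariant (2½-dimensional) EEL′ profiles are unidirectional: the planar Liouville theorem of
# KNSS kills the horizontal components (crux `TypeIliouvilleNoTypeII`, stmt-NavierStokesRegularity-0056;
# rigidity residual EEL′ of the pressure-free eternal split)

Helper file (theorems only).  On the strata where KNSS's conjecture (L) is a THEOREM the eternal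
energy Liouville statement EEL′ is unconditional (`…EternalEnergyLiouvilleAxisym.lean`: Thm 5.2).
KNSS's Theorem 5.1 — bounded weak solutions in `ℝ² × (-∞, 0)` are spatially constant — is also a
tree theorem (`KNSS2009_liouville_planar_holds`), and the tree carries the `2½`-dimensional bridge
`IsBoundedWeakNSSolutionOn.planarTrace_of_lineInvariant` (KNSS §4 (ii)).  This file draws the
consequence for the EEL′ class: for a bounded eternal Oseen-mild smooth divergence-free `v` which is
invariant under the translations `x ↦ x + δ e₁` (Lean coordinate `1`) and has `A_ess ≤ I < ∞` on all
parabolic balls,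

* `planarTrace_const_of_lineInvariant` — the components `v₀, v₂` are spatially constant on every
  slice (time translates are bounded ancient mild solutions, `ImmortalZoom.isBoundedAncientMildSolution_translate`;
  their planar traces are bounded weak planar solutions; Thm 5.1 makes a.e. slice a.e. constant; joint
  continuity upgrades "a.e. `t`, a.e. `y`" to "every `t`, every `y`");
* `horizontal_eq_zero_of_lineInvariant` — hence `v₀ ≡ 0 ≡ v₂`: the constant horizontal part is
  dominated pointwise by `‖v‖`, so its `A_ess` is `≤ I` (`cknAEss_mono_of_norm_le`) and the
  constant-killing lemma `slice_eq_zero_of_const_of_cknAEss_le` applies.  **A line-invariant EEL′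
  profile is a unidirectional flow `v = v₁(t, x₀, x₂) e₁` along its invariant direction.**

Typed residual of this stratum (NOT proved here): the axial component `v₁` is then a bounded eternal
caloric function in two variables (the Oseen term vanishes for unidirectional line-invariant fields)
with `∫∫ |∇v₁|² < ∞` by the `E`-bound, hence constant, hence `0` by the `A`-bound.
WHAT THIS IS NOT: not NS; EEL′ stays OPEN; the 2½D stratum is reduced to its axial component.
-/

noncomputable section

-- the summit and its single problem share the name `NavierStokesRegularity` (D-0017 nested layout)
set_option linter.dupNamespace false

open Set Function Filter Topology MeasureTheory Metric WithLp
open scoped NNReal ENNReal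

namespace Summit.NavierStokesRegularity.NavierStokesRegularity.Theorems.TypeIliouvilleNoTypeII.TypeIIZoom

open Literature.Analysis Literature.Analysis.FluidPDE
open Summit.NavierStokesRegularity.NavierStokesRegularity.Theorems.TypeIliouvilleNoTypeII.ImmortalZoom
  (isBoundedAncientMildSolution_translate)

variable {v : ℝ → EuclideanSpace ℝ (Fin 3) → EuclideanSpace ℝ (Fin 3)}

/-! ## `A_ess` is monotone under pointwise domination -/

/-- **`A_ess` is monotone under pointwise domination of the norm**: if `‖w(s, y)‖ ≤ ‖v(s, y)‖` for
all `(s, y)` then `A_ess(w; Q) ≤ A_ess(v; Q)` on every parabolic ball. [folklore] -/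
theorem cknAEss_mono_of_norm_le {w : ℝ → EuclideanSpace ℝ (Fin 3) → EuclideanSpace ℝ (Fin 3)}
    (hle : ∀ (s : ℝ) (y : EuclideanSpace ℝ (Fin 3)), ‖w s y‖ ≤ ‖v s y‖) (r : ℝ)
    (z : ℝ × EuclideanSpace ℝ (Fin 3)) : cknAEss r z w ≤ cknAEss r z v := by
  unfold cknAEss
  refine essSup_mono_ae (Eventually.of_forall fun s => ?_)
  have h : ∀ y, ‖w s y‖ₑ ^ 2 ≤ ‖v s y‖ₑ ^ 2 := fun y => by
    rw [← ofReal_norm, ← ofReal_norm]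
    exact pow_le_pow_left' (ENNReal.ofReal_le_ofReal (hle s y)) 2
  exact mul_le_mul' le_rfl (lintegral_mono fun y => h y)

/-! ## From "a.e. slice is constant" to "every slice is constant" -/

/-- **A closed condition holding for a.e. `t < 0` holds for all `t < 0`** — in the form needed here:
if `g : ℝ → F` is continuous and `g t = 0` for a.e. `t ∈ (-∞, 0)`, then `g t = 0` for every `t < 0`
(a non-vanishing point carries a whole interval of non-vanishing points, of positive measure).
[folklore] -/
theorem eq_zero_of_ae_Iio_of_continuous {F : Type*} [NormedAddCommGroup F] {g : ℝ → F}
    (hg : Continuous g) (hae : ∀ᵐ t ∂(volume.restrict (Iio (0 : ℝ))), g t = 0) {t₀ : ℝ}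
    (ht₀ : t₀ < 0) : g t₀ = 0 := by
  by_contra hne
  have hopen : IsOpen {t : ℝ | g t ≠ 0} := isOpen_ne_fun hg continuous_const
  obtain ⟨η, hη, hball⟩ := Metric.isOpen_iff.1 hopen t₀ hne
  set η' : ℝ := min η (-t₀) with hη'
  have hη'pos : 0 < η' := lt_min hη (by linarith)
  have hsub : Ioo (t₀ - η') t₀ ⊆ {t : ℝ | g t ≠ 0} ∩ Iio 0 := by
    intro t ht
    refine ⟨hball ?_, lt_trans ht.2 ht₀⟩
    rw [mem_ball, Real.dist_eq, abs_lt]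
    have h1 : η' ≤ η := min_le_left _ _
    constructor <;> linarith [ht.1, ht.2]
  have hnull : volume ({t : ℝ | g t ≠ 0} ∩ Iio 0) = 0 := by
    have h := hae
    rw [ae_iff, Measure.restrict_apply' measurableSet_Iio] at h
    simpa using h
  have hpos : 0 < volume (Ioo (t₀ - η') t₀) := by
    rw [Real.volume_Ioo]
    exact ENNReal.ofReal_pos.2 (by linarith)
  exact absurd (measure_mono_null hsub hnull) hpos.ne'

/-! ## The planar trace of a line-invariant profile is constant on every slice -/

/-- The embedding `y ↦ (y₀, 0, y₁)` of `ℝ²` into the plane `{x₁ = 0}` of `ℝ³` and the two planar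
components: every `x ∈ ℝ³` is `L(x₀, x₂) + x₁ e₁`. [folklore] -/
theorem eq_embed_add_single (x : EuclideanSpace ℝ (Fin 3)) :
    x = (toLp 2 ![x 0, 0, x 2] : EuclideanSpace ℝ (Fin 3)) + EuclideanSpace.single 1 (x 1) := by
  ext i
  fin_cases i <;> simp

/-- **KNSS Thm 5.1 on the eternal profile**: for a bounded eternal Oseen-mild smooth divergence-free
field invariant under `x ↦ x + δ e₁`, the components `v₀` and `v₂` are spatially constant on every time
slice. [cite: KochNadirashviliSereginSverak2009, Thm 5.1 and §4 (ii) (arXiv:0709.3599 pp. 8–9)] -/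
theorem planarTrace_const_of_lineInvariant (hv : ContDiff ℝ (⊤ : ℕ∞) (uncurry v))
    (hdiv : ∀ t, VectorCalculus.IsDivFree (v t))
    (hmild : ∀ s t : ℝ, s < t → ∀ x, v t x = heatFlow (v s) (t - s) x - oseenDuhamel 1 s v v t x)
    (hbdd : ∃ C : ℝ, ∀ t x, ‖v t x‖ ≤ C)
    (hinv : ∀ (t : ℝ) (x : EuclideanSpace ℝ (Fin 3)) (δ : ℝ), v t (x + EuclideanSpace.single 1 δ) = v t x)
    (t : ℝ) (x : EuclideanSpace ℝ (Fin 3)) : v t x 0 = v t 0 0 ∧ v t x 2 = v t 0 2 := by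
  -- continuity facts
  have hcont3 : Continuous (uncurry v) := hv.continuous
  have hslice : ∀ τ, ContDiff ℝ (⊤ : ℕ∞) (v τ) := fun τ => hv.comp (contDiff_prodMk_right τ)
  -- the translate `w(s) = v(s + (t + 1))` is a bounded ancient mild solution, hence a bounded weak one
  set T : ℝ := t + 1 with hT
  set w : ℝ → EuclideanSpace ℝ (Fin 3) → EuclideanSpace ℝ (Fin 3) := fun s => v (s + T) with hw
  have hwcont : Continuous (uncurry w) :=
    hcont3.comp ((continuous_fst.add continuous_const).prodMk continuous_snd)
  have hanc : IsBoundedAncientMildSolution 1 w := isBoundedAncientMildSolution_translate v hv hdiv hmild hbdd T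
  have hweak : IsBoundedWeakNSSolutionOn (Iio 0) isOpen_Iio 1 w :=
    hanc.isBoundedWeakNSSolutionOn one_pos
      (hwcont.aestronglyMeasurable.restrict) fun s _ => (hslice (s + T)).continuous.aestronglyMeasurable
  -- the planar trace is a bounded weak planar solution
  have hwinv : ∀ s ∈ Iio (0 : ℝ), ∀ (x : EuclideanSpace ℝ (Fin 3)) (δ : ℝ),
      w s (x + EuclideanSpace.single 1 δ) = w s x := fun s _ x δ => hinv (s + T) x δ
  have hwdiv : ∀ s ∈ Iio (0 : ℝ), IsWeaklyDivFree (w s) := fun s _ =>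
    VectorCalculus.IsDivFree.isWeaklyDivFree_holds (hdiv (s + T))
      ((hslice (s + T)).of_le (by exact_mod_cast le_top))
  have hV := hweak.planarTrace_of_lineInvariant hwcont.continuousOn hwinv hwdiv
  -- KNSS Thm 5.1
  obtain ⟨b, -, -, hae⟩ := KNSS2009_liouville_planar_holds hV
  -- the trace as a jointly continuous function
  set V : ℝ → EuclideanSpace ℝ (Fin 2) → EuclideanSpace ℝ (Fin 2) := fun s y =>
    (toLp 2 ![w s (toLp 2 ![y 0, 0, y 1]) 0, w s (toLp 2 ![y 0, 0, y 1]) 2] : EuclideanSpace ℝ (Fin 2))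
    with hVdef
  have hL : Continuous fun y : EuclideanSpace ℝ (Fin 2) => (toLp 2 ![y 0, 0, y 1] : EuclideanSpace ℝ (Fin 3)) := by
    refine (PiLp.continuous_toLp 2 _).comp ?_
    refine continuous_pi fun i => ?_
    fin_cases i
    · exact (PiLp.continuous_apply 2 _ 0)
    · exact continuous_const
    · exact (PiLp.continuous_apply 2 _ 1)
  have hVc : ∀ y, Continuous fun s => V s y := by
    intro y
    have h1 : Continuous fun s => w s (toLp 2 ![y 0, 0, y 1]) :=
      hwcont.comp (continuous_id.prodMk continuous_const)
    refine (PiLp.continuous_toLp 2 _).comp (continuous_pi fun i => ?_)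
    fin_cases i
    · exact (PiLp.continuous_apply 2 _ 0).comp h1
    · exact (PiLp.continuous_apply 2 _ 2).comp h1
  have hVy : ∀ s, Continuous (V s) := by
    intro s
    have h1 : Continuous fun y : EuclideanSpace ℝ (Fin 2) => w s (toLp 2 ![y 0, 0, y 1]) :=
      (hslice (s + T)).continuous.comp hL
    refine (PiLp.continuous_toLp 2 _).comp (continuous_pi fun i => ?_)
    fin_cases i
    · exact (PiLp.continuous_apply 2 _ 0).comp h1
    · exact (PiLp.continuous_apply 2 _ 2).comp h1
  -- a.e. slice: `V s ≡ b s`, hence `V s y = V s y'` everywhere (continuity in `y`)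
  have hae' : ∀ y y' : EuclideanSpace ℝ (Fin 2), ∀ᵐ s ∂(volume.restrict (Iio (0 : ℝ))), V s y - V s y' = 0 := by
    intro y y'
    filter_upwards [hae] with s hs
    have hconst : V s = fun _ => b s := ((hVy s).ae_eq_iff_eq volume continuous_const).1 hs
    have h1 : V s y = b s := congrFun hconst y
    have h2 : V s y' = b s := congrFun hconst y'
    rw [h1, h2, sub_self]
  -- every slice (continuity in `s`), at `s = -1`
  have hall : ∀ y y' : EuclideanSpace ℝ (Fin 2), V (-1) y = V (-1) y' := by
    intro y y'
    have h := eq_zero_of_ae_Iio_of_continuous ((hVc y).sub (hVc y')) (hae' y y') (by norm_num : (-1 : ℝ) < 0)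
    exact sub_eq_zero.1 h
  -- read off the two components at `x` and at `0`
  have hwx : w (-1) = v t := by simp only [hw, hT]; congr 1; ring
  set yx : EuclideanSpace ℝ (Fin 2) := toLp 2 ![x 0, x 2] with hyx
  have hx : v t x = v t (toLp 2 ![x 0, 0, x 2]) := by
    conv_lhs => rw [eq_embed_add_single x]
    exact hinv t _ _
  have h0 : (toLp 2 ![(0 : EuclideanSpace ℝ (Fin 2)) 0, 0, (0 : EuclideanSpace ℝ (Fin 2)) 1] :
      EuclideanSpace ℝ (Fin 3)) = 0 := by
    ext i; fin_cases i <;> simp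
  have hVx := hall yx 0
  simp only [hVdef, hwx, hyx, h0] at hVx
  have hc0 := congrArg (fun u : EuclideanSpace ℝ (Fin 2) => u 0) hVx
  have hc1 := congrArg (fun u : EuclideanSpace ℝ (Fin 2) => u 1) hVx
  simp only [Matrix.cons_val_zero, Matrix.cons_val_one] at hc0 hc1
  rw [hx]
  refine ⟨?_, ?_⟩
  · simpa using hc0
  · simpa using hc1

/-! ## The `A`-bound kills the constant horizontal part -/

/-- The horizontal part `(a, 0, c)` of a vector `(a, b, c) ∈ ℝ³` is no longer than the vector. [folklore] -/
theorem norm_horizontal_le (x : EuclideanSpace ℝ (Fin 3)) :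
    ‖(toLp 2 ![x 0, 0, x 2] : EuclideanSpace ℝ (Fin 3))‖ ≤ ‖x‖ := by
  rw [EuclideanSpace.norm_eq, EuclideanSpace.norm_eq]
  refine Real.sqrt_le_sqrt ?_
  simp [Fin.sum_univ_three]
  nlinarith [sq_nonneg (x 1)]

/-- **Line-invariant EEL′ profiles are unidirectional.**  A bounded eternal Oseen-mild smooth
divergence-free field invariant under `x ↦ x + δ e₁` whose `ess sup` scaled local energy is bounded by
some `I ≠ ∞` on all parabolic balls has `v₀ ≡ 0 ≡ v₂`: by `planarTrace_const_of_lineInvariant` the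
horizontal part `(v₀, 0, v₂)` is spatially constant on every slice, it is dominated pointwise by `‖v‖`
(`cknAEss_mono_of_norm_le`), and constants with bounded `A_ess` vanish
(`slice_eq_zero_of_const_of_cknAEss_le`). [cite: KochNadirashviliSereginSverak2009, Thm 5.1 (arXiv:0709.3599 p. 9)] -/
theorem horizontal_eq_zero_of_lineInvariant (hv : ContDiff ℝ (⊤ : ℕ∞) (uncurry v))
    (hdiv : ∀ t, VectorCalculus.IsDivFree (v t))
    (hmild : ∀ s t : ℝ, s < t → ∀ x, v t x = heatFlow (v s) (t - s) x - oseenDuhamel 1 s v v t x)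
    (hbdd : ∃ C : ℝ, ∀ t x, ‖v t x‖ ≤ C)
    (hinv : ∀ (t : ℝ) (x : EuclideanSpace ℝ (Fin 3)) (δ : ℝ), v t (x + EuclideanSpace.single 1 δ) = v t x)
    {I : ℝ≥0∞} (hI : I ≠ ⊤)
    (hA : ∀ r : ℝ, 0 < r → ∀ z : ℝ × EuclideanSpace ℝ (Fin 3), cknAEss r z v ≤ I)
    (t : ℝ) (x : EuclideanSpace ℝ (Fin 3)) : v t x 0 = 0 ∧ v t x 2 = 0 := by
  -- the (spatially constant) horizontal part as a space–time field
  set w : ℝ → EuclideanSpace ℝ (Fin 3) → EuclideanSpace ℝ (Fin 3) := fun s y =>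
    (toLp 2 ![v s y 0, 0, v s y 2] : EuclideanSpace ℝ (Fin 3)) with hw
  have hconst : ∀ (s : ℝ) (y : EuclideanSpace ℝ (Fin 3)), w s y = w s 0 := by
    intro s y
    obtain ⟨h0, h2⟩ := planarTrace_const_of_lineInvariant hv hdiv hmild hbdd hinv s y
    simp only [hw, h0, h2]
  have hle : ∀ (s : ℝ) (y : EuclideanSpace ℝ (Fin 3)), ‖w s y‖ ≤ ‖v s y‖ := fun s y =>
    norm_horizontal_le (v s y)
  have hcont : Continuous fun s => w s 0 := by
    have h0 : Continuous fun s => v s 0 := hv.continuous.comp (continuous_id.prodMk continuous_const)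
    refine (PiLp.continuous_toLp 2 _).comp (continuous_pi fun i => ?_)
    fin_cases i
    · exact (PiLp.continuous_apply 2 _ 0).comp h0
    · exact continuous_const
    · exact (PiLp.continuous_apply 2 _ 2).comp h0
  have hAw : ∀ r : ℝ, 0 < r → ∀ z : ℝ × EuclideanSpace ℝ (Fin 3), cknAEss r z w ≤ I :=
    fun r hr z => (cknAEss_mono_of_norm_le hle r z).trans (hA r hr z)
  have hzero := slice_eq_zero_of_const_of_cknAEss_le (v := w) hcont hconst hI hAw t x
  have e0 := congrArg (fun u : EuclideanSpace ℝ (Fin 3) => u 0) hzero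
  have e2 := congrArg (fun u : EuclideanSpace ℝ (Fin 3) => u 2) hzero
  simp [hw] at e0 e2
  exact ⟨e0, e2⟩

end Summit.NavierStokesRegularity.NavierStokesRegularity.Theorems.TypeIliouvilleNoTypeII.TypeIIZoom

end
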